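import Literature.Barriers.ResolutionOfSingularities.ResidualOrderUnboundedExample2Cycle
import HarnessLib

/-!
# Hauser–Perlega's SECOND example: a 3-dimensional centre in the top locus at EVERY step

`Literature/Barriers/ResolutionOfSingularities/ResidualOrderUnboundedUnforcedExample2.lean` (cell res-idea,
seat res-idea-lens-11; referee B BATCH 70 kernel glance PASS; written for referee A's first typed test on card
K11-1, rider A-K11-1-1) — the exact sibling, for the SECOND example [cite: HauserPerlega2019, §4 «Second
example: Field of characteristic p ≥ 3, n = 4, ord f = p³» (arXiv:1802.05010 TeX, p0007 L83);
`ResidualOrderUnboundedExample2Cycle.lean`: odd characteristic `p = 2h + 1`, `f = z^{p³} + F^k`], of the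
first-example file `ResidualOrderUnboundedUnforced.lean` (`Example1.seq_xw_condition_one`).

WHAT IS PROVED (bookkeeping on the printed state shapes, no new mathematics): along the WHOLE divergent
point blow-up run `Example2.seq` every monomial of every `F^k` has `(x, w)`-degree `≥ p³`; equivalently
the coordinate ideal `P = (z, x, w)` satisfies Hauser–Perlega's permissibility CONDITION (1) "`f ∈ P^{pᵉ}`"
[cite: HauserPerlega2019, §2] at every stage `k`, i.e. the `3`-dimensional regular subvariety
`V(z, x, w) ⊂ 𝔸⁵` lies in the TOP LOCUS `{ord f_k ≥ p³}` (= `Sing(J, p³)`) at every stage of every cycle,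
for every odd `p`.

«UNFORCED» — OUR READING, stated precisely: a node of a point blow-up run is called *forced* (top-locus
convention of the cell's card K11-1 / `CoordForced`) when the closed point is the only regular closed
subvariety of the top locus; the theorem exhibits a positive-dimensional one at every node, so NO node of
the second example's run is forced in that sense — the point centres are a CHOICE at every step, for this
example as for the first. This is the kernel form, for both printed examples now, of the authors' own
caveat: «in the examples one could choose at various instances a larger center than a point and thus would
end up with a different sequence of blowups for which the residual order need not tend to infinity»
[cite: HauserPerlega2019, §1 (arXiv TeX p0006 L13)], «Taking larger centers would prevent the phenomenon
from happening. We were not able to construct examples with cycles where the choice of point centers is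
forced» [cite: HauserPerlega2019, §1 (p0003 L14)], «Hence larger center than the chosen point are
admissible» [cite: HauserPerlega2019, §5 (p0010 L17)]. Only condition (1) (multiplicity) is used; the
residual clause (2) "`G ∈ P^d`" of [cite: HauserPerlega2019, §2] for this `P` is NOT addressed, and no
Moh-type bound enters.

Proof: each of the five printed state shapes `CForm / S1Form / B2Form / B3Form / B4Form` of
`Example2.StateShape` bounds the `x`- and `w`-exponents of every monomial below by quantities whose sum
is `≥ ew + d = p³(k_s + 1) ≥ p³` (using `d ≤ q` and `d' ≤ xaF`), exactly as in `bnd_of_stateShape`; then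
`stateShape_seq`.

Scope (what is NOT proved here): condition (2) for `P = (z, x, w)`; anything about other centres or about
the existence of resolutions — the file strengthens the barrier catalogue's caveat «the point centres are a
choice», nothing more. Resolution of singularities in dim ≥ 4 / char p is NOT proved by any of this.
-/

noncomputable section

open MvPolynomial Finset

open scoped BigOperators

namespace Literature.Barriers.ResolutionOfSingularities

namespace HauserPerlega

namespace Example2

variable {K : Type*} [CommRing K]

/-- `(x, w)`-degree `≥ P` on shape (0)/(6). [cite: HauserPerlega2019, §4 Second example (0), (6)] -/
theorem xw_degree_of_shapeC {P d g j ex ey ev ew : ℕ} {G : MvPolynomial (Fin 4) K} (hP : P ≤ ew + d)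
    (hS : ShapeC d g j ex ey ev ew G) : ∀ e ∈ G.support, P ≤ e 0 + e 3 := by
  intro e he
  have := hS.1 e he
  rw [eq_V4_iff] at this
  omega

/-- `(x, w)`-degree `≥ P` on shape (1). [cite: HauserPerlega2019, §4 Second example (1)] -/
theorem xw_degree_of_shape1' {P d p2v qv ex ew : ℕ} {G : MvPolynomial (Fin 4) K} (hP : P ≤ ew + d)
    (hq : d ≤ qv) (hS : Shape1' d p2v qv ex ew G) : ∀ e ∈ G.support, P ≤ e 0 + e 3 := by
  intro e he
  have := hS.1 e he
  omega

/-- `(x, w)`-degree `≥ P` on shapes (2)–(4). [cite: HauserPerlega2019, §4 Second example (2)–(4)] -/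
theorem xw_degree_of_shapeB {P d p2v ex ev vB ew xa : ℕ} {G : MvPolynomial (Fin 4) K} (hP : P ≤ ew + d)
    (hxa : d ≤ xa) (hS : ShapeB d p2v ex ev vB ew xa G) : ∀ e ∈ G.support, P ≤ e 0 + e 3 := by
  intro e he
  have := hS.1 e he
  omega

/-- Every state of the second example has all monomials of `(x, w)`-degree `≥ p³`.
[cite: HauserPerlega2019, §4 Second example] -/
theorem xw_degree_of_stateShape {h c i : ℕ} (h1 : 1 ≤ h) {G : MvPolynomial (Fin 4) K}
    (hG : StateShape h c i G) : ∀ e ∈ G.support, P3 h ≤ e 0 + e 3 := by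
  have hm : 1 ≤ mm h c := by unfold mm; omega
  unfold StateShape at hG
  split_ifs at hG with i0 i1 i2 i3 i4
  · obtain ⟨ka, kb, kr, ks, ew, hw, hS⟩ := hG
    exact xw_degree_of_shapeC (by rw [hw]; exact Nat.le_mul_of_pos_right _ (Nat.succ_pos _)) hS
  · obtain ⟨k, ks, ew, hw, hS⟩ := hG
    exact xw_degree_of_shape1' (by rw [hw]; exact Nat.le_mul_of_pos_right _ (Nat.succ_pos _)) (le_qq h c) hS
  · obtain ⟨k, ks, ew, r, hw, hr, hS⟩ := hG
    exact xw_degree_of_shapeB (by rw [hw]; exact Nat.le_mul_of_pos_right _ (Nat.succ_pos _))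
      (by unfold xaF; omega) hS
  · obtain ⟨k, ks, ew, Δ, hw, hΔ, hS⟩ := hG
    exact xw_degree_of_shapeB (by rw [hw]; exact Nat.le_mul_of_pos_right _ (Nat.succ_pos _))
      (by unfold xaF; omega) hS
  · obtain ⟨k, ks, ew, hw, hS⟩ := hG
    have h' := xw_degree_of_shapeB (P := P3 h) (by rw [hw]; exact Nat.le_mul_of_pos_right _ (Nat.succ_pos _))
      (by rw [xaF_eq]; omega) hS
    exact h'
  · obtain ⟨ka, kb, kr, ks, ew, hw, hS⟩ := hG
    exact xw_degree_of_shapeC (by rw [hw]; exact Nat.le_mul_of_pos_right _ (Nat.succ_pos _)) hS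

/-- **Along the whole run of the second example every monomial of `F^k` has `(x, w)`-degree `≥ p³`.**
[cite: HauserPerlega2019, §4 Second example] -/
theorem xw_degree_seq {h : ℕ} [Fact (Nat.Prime (2 * h + 1))] [CharP K (2 * h + 1)] [IsDomain K]
    (h1 : 1 ≤ h) (k : ℕ) : ∀ e ∈ (seq K h k).support, P3 h ≤ e 0 + e 3 :=
  xw_degree_of_stateShape h1 (stateShape_seq h1 k)

/-- **At EVERY step of Hauser–Perlega's second divergent run the `3`-dimensional coordinate centre
`P = (z, x, w)` satisfies the permissibility condition (1) "`f ∈ P^{p³}`"**: every monomial of `F^k` has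
`Γ`-degree `≥ p³` for `Γ = {x, w}` — equivalently `V(z, x, w)` lies in the top locus
`{ord (z^{p³} + F^k) ≥ p³}` at every stage, so no node of the run is a forced point centre.
[cite: HauserPerlega2019, §2 (permissible center (1)) and §4 Second example] -/
theorem seq_xw_condition_one {h : ℕ} [Fact (Nat.Prime (2 * h + 1))] [CharP K (2 * h + 1)] [IsDomain K]
    (h1 : 1 ≤ h) (k : ℕ) : ∀ d ∈ (seq K h k).support, P3 h ≤ ∑ i ∈ ({0, 3} : Finset (Fin 4)), d i := by
  intro d hd
  rw [Finset.sum_pair (by decide)]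
  exact xw_degree_seq h1 k d hd

end Example2

end HauserPerlega

end Literature.Barriers.ResolutionOfSingularities
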